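import Summits.BirchSwinnertonDyer.BirchSwinnertonDyer.Theorems.PrintCf2SplitBadTwoLocSurjLimitExhaustion
import Summits.BirchSwinnertonDyer.BirchSwinnertonDyer.Theorems.ResidualThetaTransportAtTwoRlfSharpEigenLocal
import Summits.BirchSwinnertonDyer.BirchSwinnertonDyer.Theorems.SmallImageMuTransferMuTransferX9SelmerDualLocalFine
import Summits.BirchSwinnertonDyer.Rank1Residual.X11b.CoinvariantsDescent
import Literature.NumberTheory.GaloisRepresentations.NumberFieldCdTwoProofs
import Literature.NumberTheory.EllipticCurves.GreenbergVatsal2000.GreenbergSelmerGroups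
import HarnessLib

/-!
# Crux `PrintCf2.SplitBadTwoRankOneOfFacts` (stmt-BirchSwinnertonDyer-20368), S3n′-FACT-FREE road, brick R3a: THE LIMIT STEP —
# local surjectivity at the deep finite layers `K_n = K̄^{κ⁻¹(pⁿℤ_p)}` ⟹ local surjectivity (LS↑) over `K_∞ = K̄^{ker κ}`

Cell `bsd-print-cf2`, EXTRA WIDTH seat `bsd-line-cf2-p1-w3` g13 (prover-bsd-line-cf2-p1-w3-g13-0); `--supports stmt-BirchSwinnertonDyer-20368`
(helper, Theses-free). HONEST FRAMING: nothing here closes the crux or a registered stub; BSD is not proved by any of this; no summit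
statement is proved by this seat. No definition, no named fact, no `sorry`. UNCONDITIONAL and GENERIC: any number field `K`, any prime `p`,
any `ℤ_p`-extension `κ`, any discrete `Γ_K`-module `M` with open stabilisers, any side predicate `P` on the finite places.

WHAT (memo `Cruxes/SplitBadTwoRankOneOfFacts/S3N-FACTFREE-w2g14.md` §2/§4, bricks R2 → R3a → R3). The consumer -w4 g12
`UpperBaseLift.baseLift_unr₂_of_locSurj` (p697xxx, `Theorems/PrintCf2SplitBadTwoUpperBaseLift.lean`) displays the hypothesis
 (LS↑) = `hLS`: for every finite set `T` of `P`-places and every family of local targets `τ w q ∈ H¹(ker κ ∩ D_w, M)` indexed by the places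
 `q ∈ D_w \ Γ_K / ker κ` of `K_∞` above `w ∈ T` (read through `conj_{q.out}`), there is `z ∈ H¹(ker κ, M)` matching every target modulo the
 classes unramified at `w` and unramified at every place of `K_∞` above the `P`-places outside `T`.
The supplier (R2, -w5 g7: Poitou–Tate + (PRO-NULL) at the finite layers) delivers the SAME statement with `ker κ` replaced by the open
subgroup `κ⁻¹(pⁿℤ_p) = κ.layerSubgroup n` («(SUR*_n)», `hLSn` below), for all `n ≥ n₀`. THIS FILE is the passage to the limit:
* `locSurj_kerSubgroup_of_forall_layerSubgroup` — **(∀ n ≥ n₀, (SUR*_n)) ∧ (the places of `K_∞` above each `P`-place are finite in number)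
  ⟹ (LS↑)**, the conclusion being `hLS` VERBATIM (with `P w := (↑p ∉ w.asIdeal ∨ w = v̄)` it is literally the hypothesis of
  `baseLift_unr₂_of_locSurj`; the finiteness is -w8 g4 `LineDoubleCoset.finite_doubleCosetQuotient_decomp_of_line` / `…_of_frame` on road α).
Mechanism: (1) BIRTH — every local target is restricted from a finite layer (`LocSurjLimit.exists_resOfLe_eq_of_iInf_le`, file 1, on the
compact group `D_w` with `ker κ ∩ D_w = ⋂ₙ (κ⁻¹(pⁿℤ_p) ∩ D_w)`), and finitely many targets are born by a common layer
(`exists_layer_resOfLe_decompIn_eq`); (2) SEPARATION — distinct places of `K_∞` above `w` are distinct places of `K_n` for `n ≫ 0`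
(`eventually_doubleCoset_mk_ne`: compactness of `D_w`, generic); (3) TRANSPORT — at layer `N` the target at the place `Q ∋ q.out` of `K_N`,
`Q.out = d·q.out·u` (`d ∈ D_w`, `u ∈ Gal(K̄/K_N)`), is `conj_d` of the birth lift (`conj_u` is the identity on `H¹(K_N, M)`, `conj_d` commutes with
localisation and preserves the unramified local classes: `matching_of_matching_conj`); (4) DESCENT — restriction `K_N → K_∞` commutes with
`conj`, with localisation and with the unramified conditions (`matching_resOfLe`, `resOfLe_mem_unramifiedKer`).
presearch: Greenberg–Vatsal 2000 §2 Prop. 2.1 (P_Σ over ℚ_∞ as a limit over the layers); Greenberg LNM 1716 §4 Props. 4.13–4.15; Serre I §2.2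
Prop. 8 — «lim H¹(K_n) = H¹(K_∞)» is folklore; no source states the place-indexed bookkeeping; no new fact. beyond-print theorem: no.

References: [GreenbergVatsal2000] §2 Prop. 2.1; [GreenbergLNM1716] §3 Lemma 3.2, §4 Props. 4.13–4.15; [SerreGaloisCohomology1997] I §2.2
Prop. 8, I §2.5; [NeukirchSchmidtWingberg2008] I §5, (1.6.3).
-/

noncomputable section

set_option linter.dupNamespace false
set_option autoImplicit false

open scoped Classical Pointwise
open Filter Topology
open NumberField IsDedekindDomain Field
open Literature.NumberTheory.EllipticCurves Literature.NumberTheory.EllipticCurves.GreenbergSelmer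
open Literature.NumberTheory.EllipticCurves.GreenbergVatsal2000
open Literature.NumberTheory.GaloisRepresentations
open Summit.BirchSwinnertonDyer.Rank1Residual.X11b
open Summit.BirchSwinnertonDyer.BirchSwinnertonDyer.Theorems.SignedEC.SharpEigen (inertiaIn_normal)
open Summit.BirchSwinnertonDyer.BirchSwinnertonDyer.Rank1Residual.SelmerDual (decompIn_normal)

namespace Summit.BirchSwinnertonDyer.BirchSwinnertonDyer.Theorems.PrintCf2.LocSurjLimit

/-! ## §1. Separation of double cosets at a deep stage (generic compact group) -/

section Separation

variable {G : Type} [Group G] [TopologicalSpace G] [IsTopologicalGroup G] [CompactSpace G]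

/-- **Distinct `D \ G / H` double cosets are distinct `D \ G / Sₙ` double cosets for `n ≫ 0`** when `⋂ Sₙ ≤ H` (`D`, `Sₙ` closed, `Sₙ`
antitone, `G` compact): if `b ∈ D·a·Sₙ` for every `n`, the closed non-empty decreasing sets `{d ∈ D : a⁻¹d⁻¹b ∈ Sₙ}` have a common point,
so `b ∈ D·a·H`. [cite: SerreGaloisCohomology1997, I §2.2 (compactness)] [cite: NeukirchSchmidtWingberg2008, I §5] -/
theorem eventually_doubleCoset_mk_ne (D : Subgroup G) (hD : IsClosed (D : Set G)) (S : ℕ → Subgroup G) (hS : Antitone S)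
    (hcl : ∀ k, IsClosed ((S k : Subgroup G) : Set G)) (H : Subgroup G) (hHS : (⨅ k, S k) ≤ H) {a b : G}
    (hab : DoubleCoset.mk D H a ≠ DoubleCoset.mk D H b) :
    ∀ᶠ n in atTop, DoubleCoset.mk D (S n) a ≠ DoubleCoset.mk D (S n) b := by
  -- one separating stage suffices (later stages are finer)
  suffices h : ∃ n, DoubleCoset.mk D (S n) a ≠ DoubleCoset.mk D (S n) b by
    obtain ⟨n, hn⟩ := h
    refine eventually_atTop.2 ⟨n, fun m hm hEq ↦ hn ?_⟩
    obtain ⟨d, hd, s, hs, hb⟩ := (DoubleCoset.eq D (S m) a b).1 hEq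
    exact (DoubleCoset.eq D (S n) a b).2 ⟨d, hd, s, hS hm hs, hb⟩
  by_contra hall
  push Not at hall
  set t : ℕ → Set G := fun n ↦ (D : Set G) ∩ (fun d ↦ a⁻¹ * d⁻¹ * b) ⁻¹' (S n : Set G) with ht
  have hcont : Continuous fun d : G ↦ a⁻¹ * d⁻¹ * b := (continuous_const.mul continuous_inv).mul continuous_const
  have htcl : ∀ n, IsClosed (t n) := fun n ↦ hD.inter ((hcl n).preimage hcont)
  have htne : ∀ n, (t n).Nonempty := fun n ↦ by
    obtain ⟨d, hd, s, hs, hb⟩ := (DoubleCoset.eq D (S n) a b).1 (hall n)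
    refine ⟨d, hd, ?_⟩
    change a⁻¹ * d⁻¹ * b ∈ (S n : Set G)
    rw [hb, show a⁻¹ * d⁻¹ * (d * a * s) = s by group]
    exact hs
  have htd : ∀ n, t (n + 1) ⊆ t n := fun n x hx ↦ ⟨hx.1, hS (Nat.le_succ n) hx.2⟩
  obtain ⟨d, hd⟩ := IsCompact.nonempty_iInter_of_sequence_nonempty_isCompact_isClosed t htd htne
    (htcl 0).isCompact htcl
  rw [Set.mem_iInter] at hd
  have hmem : a⁻¹ * d⁻¹ * b ∈ H := hHS (Subgroup.mem_iInf.2 fun n ↦ (hd n).2)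
  exact hab ((DoubleCoset.eq D H a b).2 ⟨d, (hd 0).1, a⁻¹ * d⁻¹ * b, hmem, by group⟩)

end Separation

/-! ## §2. The local groups `Gal(K̄/K_n) ∩ D_w` along the layers; birth of local targets -/

section Layers

variable {K : Type} [Field K] [NumberField K] {p : ℕ} [Fact p.Prime] (κ : ZpExtension K p)
  (M : Type) [AddCommGroup M] [DistribMulAction (absoluteGaloisGroup K) M] [TopologicalSpace M] [DiscreteTopology M]
  (w : HeightOneSpectrum (𝓞 K))

omit [Fact p.Prime] in
/-- `H ∩ D_w ≤ H' ∩ D_w` in `D_w` for `H ≤ H'`. [folklore] -/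
theorem decompIn_le_decompIn {H H' : Subgroup (absoluteGaloisGroup K)} (h : H ≤ H') : decompIn H w ≤ decompIn H' w :=
  fun x hx ↦ (mem_decompIn_iff H' w x).2 (h ((mem_decompIn_iff H w x).1 hx))

omit [Fact p.Prime] in
/-- `H ∩ I_w ≤ H' ∩ I_w` in `D_w` for `H ≤ H'`. [folklore] -/
theorem inertiaIn_le_inertiaIn {H H' : Subgroup (absoluteGaloisGroup K)} (h : H ≤ H') : inertiaIn H w ≤ inertiaIn H' w :=
  fun x hx ↦ (mem_inertiaIn_iff H' w x).2 ⟨h ((mem_inertiaIn_iff H w x).1 hx).1, ((mem_inertiaIn_iff H w x).1 hx).2⟩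

omit [Fact p.Prime] in
/-- The underlying set of `decompIn H w ≤ D_w` is the preimage of `H`. [folklore] -/
theorem coe_decompIn_eq_preimage (H : Subgroup (absoluteGaloisGroup K)) :
    ((decompIn H w : Subgroup (decomp (K := K) w)) : Set (decomp (K := K) w)) =
      Subtype.val ⁻¹' (H : Set (absoluteGaloisGroup K)) :=
  Set.ext fun x ↦ mem_decompIn_iff H w x

/-- `⋂ₙ (κ⁻¹(pⁿℤ_p) ∩ D_w) ≤ ker κ ∩ D_w` (`⋂ₙ κ⁻¹(pⁿℤ_p) = ker κ`). [cite: Washington1997, §13.1] -/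
theorem iInf_decompIn_layerSubgroup_le :
    (⨅ n, decompIn (κ.layerSubgroup n) w) ≤ decompIn κ.kerSubgroup w := by
  intro x hx
  rw [mem_decompIn_iff]
  have h : (x : absoluteGaloisGroup K) ∈ ⨅ n, κ.layerSubgroup n :=
    Subgroup.mem_iInf.2 fun n ↦ (mem_decompIn_iff _ w x).1 (Subgroup.mem_iInf.1 hx n)
  rw [iInf_layerSubgroup_eq_ker] at h
  exact h

/-- **Birth of a local target at a finite layer.** Every class of `H¹(ker κ ∩ D_w, M)` is restricted from `H¹(κ⁻¹(pⁿℤ_p) ∩ D_w, M)`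
for some `n` (file 1 on the compact group `D_w`). [cite: SerreGaloisCohomology1997, I §2.2 Prop. 8] [cite: GreenbergLNM1716, §3 Lemma 3.2] -/
theorem exists_layer_resOfLe_decompIn_eq
    (hstab : ∀ m : M, IsOpen (MulAction.stabilizer (absoluteGaloisGroup K) m : Set (absoluteGaloisGroup K)))
    (τ : subgroupH1 (decompIn κ.kerSubgroup w) M) :
    ∃ (n : ℕ) (τ' : subgroupH1 (decompIn (κ.layerSubgroup n) w) M),
      resOfLe M (decompIn_le_decompIn w (κ.kerSubgroup_le_layerSubgroup n)) τ' = τ := by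
  haveI : CompactSpace (absoluteGaloisGroup K) := absoluteGaloisGroup_compactSpace K
  haveI : CompactSpace (decomp (K := K) w) := isCompact_iff_compactSpace.mp (Coinv.isClosed_decomp w).isCompact
  have hcont : ∀ m : M, Continuous fun g : decomp (K := K) w ↦ g • m := fun m ↦
    (continuous_smul_of_isOpen_stabilizer hstab m).comp continuous_subtype_val
  have hS : Antitone fun n ↦ decompIn (κ.layerSubgroup n) w :=
    fun m n hmn ↦ decompIn_le_decompIn w (κ.layerSubgroup_antitone hmn)
  have hcl : ∀ n, IsClosed ((decompIn (κ.layerSubgroup n) w : Subgroup (decomp (K := K) w)) : Set (decomp (K := K) w)) :=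
    fun n ↦ by
      rw [coe_decompIn_eq_preimage]
      exact (Subgroup.isClosed_of_isOpen _ (κ.isOpen_layerSubgroup n)).preimage continuous_subtype_val
  exact exists_resOfLe_eq_of_iInf_le hcont _ hS hcl (decompIn κ.kerSubgroup w)
    (fun n ↦ decompIn_le_decompIn w (κ.kerSubgroup_le_layerSubgroup n)) (iInf_decompIn_layerSubgroup_le κ w) τ

/-- **Birth, eventually form**: a local target born at layer `n` is born at every deeper layer. [cite: SerreGaloisCohomology1997, I §2.2 Prop. 8] -/
theorem eventually_exists_resOfLe_decompIn_eq
    (hstab : ∀ m : M, IsOpen (MulAction.stabilizer (absoluteGaloisGroup K) m : Set (absoluteGaloisGroup K)))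
    (τ : subgroupH1 (decompIn κ.kerSubgroup w) M) :
    ∀ᶠ n in atTop, ∃ τ' : subgroupH1 (decompIn (κ.layerSubgroup n) w) M,
      resOfLe M (decompIn_le_decompIn w (κ.kerSubgroup_le_layerSubgroup n)) τ' = τ := by
  obtain ⟨n, τ', hτ'⟩ := exists_layer_resOfLe_decompIn_eq κ M w hstab τ
  refine eventually_atTop.2 ⟨n, fun m hm ↦ ⟨resOfLe M (decompIn_le_decompIn w (κ.layerSubgroup_antitone hm)) τ', ?_⟩⟩
  rw [← hτ', ← AddMonoidHom.comp_apply, resOfLe_comp_holds]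

end Layers

/-! ## §3. Transport of the matching condition: conjugation at one layer, restriction between layers -/

section Transport

variable {K : Type} [Field K] [NumberField K]
  (M : Type) [AddCommGroup M] [DistribMulAction (absoluteGaloisGroup K) M] [TopologicalSpace M] [DiscreteTopology M]
  (w : HeightOneSpectrum (𝓞 K))

/-- Localisation `H¹(U, M) → H¹(U ∩ D_w, M)` intertwines `conj_d` (`d ∈ D_w`) computed in `Γ_K` and in `D_w` (both composites are induced
by `(x ↦ d⁻¹xd, m ↦ d•m)`; twin of `SmallImage.resH1Hom_decompInToH_conjH1`). [cite: NeukirchSchmidtWingberg2008, I §5] -/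
theorem loc_conjH1 (U : Subgroup (absoluteGaloisGroup K)) [U.Normal] [(decompIn U w).Normal] (d : decomp (K := K) w)
    (y : subgroupH1 U M) :
    resH1Hom (decompInToH U w) (AddMonoidHom.id M) (fun _ _ ↦ rfl) (conjH1 U M (d : absoluteGaloisGroup K) y) =
      conjH1 (decompIn U w) M d (resH1Hom (decompInToH U w) (AddMonoidHom.id M) (fun _ _ ↦ rfl) y) := by
  rw [conjH1, conjH1, ← AddMonoidHom.comp_apply, resH1Hom_comp, ← AddMonoidHom.comp_apply, resH1Hom_comp]
  refine DFunLike.congr_fun (resH1Hom_congr (ContinuousMonoidHom.ext fun x ↦ Subtype.ext ?_) (AddMonoidHom.ext fun _ ↦ rfl) _ _) y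
  change (d : absoluteGaloisGroup K)⁻¹ * ((x : decomp (K := K) w) : absoluteGaloisGroup K) * d =
    (((d⁻¹ * (x : decomp (K := K) w) * d : decomp (K := K) w)) : absoluteGaloisGroup K)
  push_cast
  rfl

/-- Localisation commutes with restriction between layers `U ≤ U'` (twin of `SmallImage.resOfLe_decompIn_resH1Hom_decompInToH`).
[cite: NeukirchSchmidtWingberg2008, I §5] -/
theorem loc_resOfLe {U U' : Subgroup (absoluteGaloisGroup K)} (h : U ≤ U') (y : subgroupH1 U' M) :
    resH1Hom (decompInToH U w) (AddMonoidHom.id M) (fun _ _ ↦ rfl) (resOfLe M h y) =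
      resOfLe M (decompIn_le_decompIn w h) (resH1Hom (decompInToH U' w) (AddMonoidHom.id M) (fun _ _ ↦ rfl) y) := by
  rw [resOfLe, resOfLe, ← AddMonoidHom.comp_apply, resH1Hom_comp, ← AddMonoidHom.comp_apply, resH1Hom_comp]
  exact DFunLike.congr_fun (resH1Hom_congr (ContinuousMonoidHom.ext fun _ ↦ rfl) rfl _ _) y

/-- The unramified test map `H¹(U, M) → H¹(U ∩ I_w, M)` is «restrict to `U ∩ I_w` after localising at `U ∩ D_w`». [folklore] -/
theorem resH1Hom_inertiaInToH_eq (U : Subgroup (absoluteGaloisGroup K)) (y : subgroupH1 U M) :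
    resH1Hom (inertiaInToH U w) (AddMonoidHom.id M) (fun _ _ ↦ rfl) y =
      resOfLe M (inertiaIn_le_decompIn U w) (resH1Hom (decompInToH U w) (AddMonoidHom.id M) (fun _ _ ↦ rfl) y) := by
  rw [resOfLe, ← AddMonoidHom.comp_apply, resH1Hom_comp]
  exact DFunLike.congr_fun (resH1Hom_congr (ContinuousMonoidHom.ext fun _ ↦ rfl) rfl _ _) y

/-- **Restriction between layers preserves «unramified at `w`»**: `res_{U' → U}` maps `unramifiedKer U' M w` into `unramifiedKer U M w`.
[cite: GreenbergVatsal2000, §2 p. 17] -/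
theorem resOfLe_mem_unramifiedKer {U U' : Subgroup (absoluteGaloisGroup K)} (h : U ≤ U') {y : subgroupH1 U' M}
    (hy : y ∈ unramifiedKer U' M w) : resOfLe M h y ∈ unramifiedKer U M w := by
  change resH1Hom (inertiaInToH U' w) (AddMonoidHom.id M) (fun _ _ ↦ rfl) y = 0 at hy
  change resH1Hom (inertiaInToH U w) (AddMonoidHom.id M) (fun _ _ ↦ rfl) (resOfLe M h y) = 0
  rw [resH1Hom_inertiaInToH_eq] at hy ⊢
  rw [loc_resOfLe M w h, ← AddMonoidHom.comp_apply, resOfLe_comp_holds,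
    show resOfLe M ((inertiaIn_le_decompIn U w).trans (decompIn_le_decompIn w h)) =
      (resOfLe M (inertiaIn_le_inertiaIn w h)).comp (resOfLe M (inertiaIn_le_decompIn U' w)) from
      (resOfLe_comp_holds _ _).symm, AddMonoidHom.comp_apply, hy, map_zero]

/-- **DESCENT of the matching condition from `U'` to `U ≤ U'`.** If `z' ∈ H¹(U', M)` matches the target `t'` at the place read through
`conj_r` modulo the classes unramified at `w`, then `res z'` matches `res t'`. [cite: NeukirchSchmidtWingberg2008, I §5] -/
theorem matching_resOfLe {U U' : Subgroup (absoluteGaloisGroup K)} [U.Normal] [U'.Normal] (h : U ≤ U') (r : absoluteGaloisGroup K)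
    (z' : subgroupH1 U' M) (t' : subgroupH1 (decompIn U' w) M)
    (hm : resOfLe M (inertiaIn_le_decompIn U' w)
      (resH1Hom (decompInToH U' w) (AddMonoidHom.id M) (fun _ _ ↦ rfl) (conjH1 U' M r z') - t') = 0) :
    resOfLe M (inertiaIn_le_decompIn U w)
      (resH1Hom (decompInToH U w) (AddMonoidHom.id M) (fun _ _ ↦ rfl) (conjH1 U M r (resOfLe M h z')) -
        resOfLe M (decompIn_le_decompIn w h) t') = 0 := by
  have hnat : conjH1 U M r (resOfLe M h z') = resOfLe M h (conjH1 U' M r z') := by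
    have e := resOfLe_comp_conjH1_holds (M := M) h r
    exact (DFunLike.congr_fun e z').symm
  rw [hnat, loc_resOfLe M w h, ← map_sub, ← AddMonoidHom.comp_apply, resOfLe_comp_holds,
    show resOfLe M ((inertiaIn_le_decompIn U w).trans (decompIn_le_decompIn w h)) =
      (resOfLe M (inertiaIn_le_inertiaIn w h)).comp (resOfLe M (inertiaIn_le_decompIn U' w)) from
      (resOfLe_comp_holds _ _).symm, AddMonoidHom.comp_apply, hm, map_zero]

/-- **TRANSPORT of the matching condition along a change of representative at one layer.** `U ⊴ Γ_K`, `d ∈ D_w`, `u ∈ U`, `r ∈ Γ_K`: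
if `z` matches `conj_d t` at the place read through `conj_{d·r·u}`, then `z` matches `t` at the place read through `conj_r` (`conj_u = id` on
`H¹(U, M)`; `conj_d` commutes with localisation and with restriction to `U ∩ I_w ⊴ D_w`, and is invertible there).
[cite: SerreLocalFields1979, VII §5 Prop. 3] [cite: NeukirchSchmidtWingberg2008, I §5, (1.6.3)] -/
theorem matching_of_matching_conj (U : Subgroup (absoluteGaloisGroup K)) [U.Normal] [(decompIn U w).Normal] [(inertiaIn U w).Normal]
    (d : decomp (K := K) w) {u : absoluteGaloisGroup K} (hu : u ∈ U) (r : absoluteGaloisGroup K)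
    (z : subgroupH1 U M) (t : subgroupH1 (decompIn U w) M)
    (hm : resOfLe M (inertiaIn_le_decompIn U w)
      (resH1Hom (decompInToH U w) (AddMonoidHom.id M) (fun _ _ ↦ rfl) (conjH1 U M ((d : absoluteGaloisGroup K) * r * u) z) -
        conjH1 (decompIn U w) M d t) = 0) :
    resOfLe M (inertiaIn_le_decompIn U w)
      (resH1Hom (decompInToH U w) (AddMonoidHom.id M) (fun _ _ ↦ rfl) (conjH1 U M r z) - t) = 0 := by
  -- `conj_{d r u} z = conj_d (conj_r z)`
  have h1 : conjH1 U M ((d : absoluteGaloisGroup K) * r * u) z = conjH1 U M (d : absoluteGaloisGroup K) (conjH1 U M r z) := by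
    rw [conjH1_mul_holds U M, conjH1_mul_holds U M, AddMonoidHom.comp_apply, AddMonoidHom.comp_apply,
      conjH1_of_mem_holds U M hu, AddMonoidHom.id_apply]
  rw [h1, loc_conjH1 M w U d, ← map_sub] at hm
  set X := resH1Hom (decompInToH U w) (AddMonoidHom.id M) (fun _ _ ↦ rfl) (conjH1 U M r z) - t with hX
  -- `res_I ∘ conj_d = conj_d ∘ res_I` in `D_w`
  have hnat := resOfLe_comp_conjH1_holds (G := decomp (K := K) w) (M := M) (inertiaIn_le_decompIn U w) d
  have h2 : conjH1 (inertiaIn U w) M d (resOfLe M (inertiaIn_le_decompIn U w) X) = 0 := by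
    rw [← AddMonoidHom.comp_apply, ← hnat, AddMonoidHom.comp_apply, hm]
  -- `conj_{d⁻¹} ∘ conj_d = id`
  have h3 := congrArg (conjH1 (inertiaIn U w) M d⁻¹) h2
  rwa [map_zero, ← AddMonoidHom.comp_apply, ← conjH1_mul_holds (inertiaIn U w) M, inv_mul_cancel,
    conjH1_one_holds (inertiaIn U w) M, AddMonoidHom.id_apply] at h3

end Transport

/-! ## §4. The limit step -/

section Limit

variable {K : Type} [Field K] [NumberField K] {p : ℕ} [Fact p.Prime] (κ : ZpExtension K p)
  (M : Type) [AddCommGroup M] [DistribMulAction (absoluteGaloisGroup K) M] [TopologicalSpace M] [DiscreteTopology M]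

/-- **THE LIMIT STEP (SUR*_n) ∀ n ≫ 0 ⟹ (LS↑).** Let `κ` be a `ℤ_p`-extension of a number field `K`, `M` a discrete `Γ_K`-module with open
stabilisers, `P` a predicate on the finite places of `K` such that above every `P`-place there are finitely many places of `K_∞ = K̄^{ker κ}`
(`Finite (D_w \ Γ_K / ker κ)`). Suppose that for every layer `n ≥ n₀` the local surjectivity holds over `K_n = K̄^{κ⁻¹(pⁿℤ_p)}`: for every
finite set `T` of `P`-places and every family of targets `τ w Q ∈ H¹(κ⁻¹(pⁿℤ_p) ∩ D_w, M)`, `w ∈ T`, `Q` a place of `K_n` above `w` (a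
`D_w \ Γ_K / κ⁻¹(pⁿℤ_p)` double coset, read through `conj_{Q.out}`), some `z ∈ H¹(K_n, M)` matches every target modulo the classes
unramified at `w` and is unramified at every place of `K_n` above the `P`-places outside `T`. Then the same holds over `K_∞` — the
hypothesis `hLS` of `UpperBaseLift.baseLift_unr₂_of_locSurj` VERBATIM when `P w := (↑p ∉ w.asIdeal ∨ w = v̄)`.
[cite: GreenbergVatsal2000, §2 Prop. 2.1] [cite: GreenbergLNM1716, §4 Props. 4.13–4.15] [cite: SerreGaloisCohomology1997, I §2.2 Prop. 8] -/
theorem locSurj_kerSubgroup_of_forall_layerSubgroup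
    (hstab : ∀ m : M, IsOpen (MulAction.stabilizer (absoluteGaloisGroup K) m : Set (absoluteGaloisGroup K)))
    (P : HeightOneSpectrum (𝓞 K) → Prop)
    (hfin : ∀ w, P w → Finite (DoubleCoset.Quotient (decomp (K := K) w : Set (absoluteGaloisGroup K))
      (κ.kerSubgroup : Set (absoluteGaloisGroup K))))
    (n₀ : ℕ)
    (hLSn : ∀ n, n₀ ≤ n → ∀ (T : Finset (HeightOneSpectrum (𝓞 K))), (∀ w ∈ T, P w) →
      ∀ τ : (w : HeightOneSpectrum (𝓞 K)) →
        DoubleCoset.Quotient (decomp (K := K) w : Set (absoluteGaloisGroup K)) (κ.layerSubgroup n : Set (absoluteGaloisGroup K)) →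
          subgroupH1 (decompIn (κ.layerSubgroup n) w) M,
      ∃ z : subgroupH1 (κ.layerSubgroup n) M,
        (∀ w ∈ T, ∀ Q : DoubleCoset.Quotient (decomp (K := K) w : Set (absoluteGaloisGroup K))
            (κ.layerSubgroup n : Set (absoluteGaloisGroup K)),
          resOfLe M (inertiaIn_le_decompIn (κ.layerSubgroup n) w)
            (resH1Hom (decompInToH (κ.layerSubgroup n) w) (AddMonoidHom.id M) (fun _ _ ↦ rfl)
              (conjH1 (κ.layerSubgroup n) M Q.out z) - τ w Q) = 0) ∧
        (∀ w : HeightOneSpectrum (𝓞 K), w ∉ T → P w →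
          ∀ σ : absoluteGaloisGroup K, conjH1 (κ.layerSubgroup n) M σ z ∈ unramifiedKer (κ.layerSubgroup n) M w)) :
    ∀ (T : Finset (HeightOneSpectrum (𝓞 K))), (∀ w ∈ T, P w) →
      ∀ τ : (w : HeightOneSpectrum (𝓞 K)) →
        DoubleCoset.Quotient (decomp (K := K) w : Set (absoluteGaloisGroup K)) (κ.kerSubgroup : Set (absoluteGaloisGroup K)) →
          subgroupH1 (decompIn κ.kerSubgroup w) M,
      ∃ z : subgroupH1 κ.kerSubgroup M,
        (∀ w ∈ T, ∀ q : DoubleCoset.Quotient (decomp (K := K) w : Set (absoluteGaloisGroup K)) (κ.kerSubgroup : Set (absoluteGaloisGroup K)),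
          resOfLe M (inertiaIn_le_decompIn κ.kerSubgroup w)
            (resH1Hom (decompInToH κ.kerSubgroup w) (AddMonoidHom.id M) (fun _ _ ↦ rfl) (conjH1 κ.kerSubgroup M q.out z) - τ w q) = 0) ∧
        (∀ w : HeightOneSpectrum (𝓞 K), w ∉ T → P w →
          ∀ σ : absoluteGaloisGroup K, conjH1 κ.kerSubgroup M σ z ∈ unramifiedKer κ.kerSubgroup M w) := by
  intro T hT τ
  haveI : CompactSpace (absoluteGaloisGroup K) := absoluteGaloisGroup_compactSpace K
  haveI hDN : ∀ (U : Subgroup (absoluteGaloisGroup K)) [U.Normal] (w : HeightOneSpectrum (𝓞 K)), (decompIn U w).Normal :=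
    fun U _ w ↦ decompIn_normal U w
  haveI hIN : ∀ (U : Subgroup (absoluteGaloisGroup K)) [U.Normal] (w : HeightOneSpectrum (𝓞 K)), (inertiaIn U w).Normal :=
    fun U _ w ↦ inertiaIn_normal U w
  -- (1) BIRTH: every target is born at every deep enough layer
  have hbirth : ∀ᶠ n in atTop, ∀ w ∈ T, ∀ q : DoubleCoset.Quotient (decomp (K := K) w : Set (absoluteGaloisGroup K))
      (κ.kerSubgroup : Set (absoluteGaloisGroup K)),
      ∃ τ' : subgroupH1 (decompIn (κ.layerSubgroup n) w) M,
        resOfLe M (decompIn_le_decompIn w (κ.kerSubgroup_le_layerSubgroup n)) τ' = τ w q := by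
    refine (eventually_all_finset T).2 fun w hw ↦ ?_
    haveI := hfin w (hT w hw)
    exact eventually_all.2 fun q ↦ eventually_exists_resOfLe_decompIn_eq κ M w hstab (τ w q)
  -- (2) SEPARATION: distinct places of `K_∞` above `w ∈ T` are distinct places of every deep enough layer
  have hsep : ∀ᶠ n in atTop, ∀ w ∈ T, ∀ q q' : DoubleCoset.Quotient (decomp (K := K) w : Set (absoluteGaloisGroup K))
      (κ.kerSubgroup : Set (absoluteGaloisGroup K)), q ≠ q' →
      DoubleCoset.mk (decomp (K := K) w) (κ.layerSubgroup n) q.out ≠ DoubleCoset.mk (decomp (K := K) w) (κ.layerSubgroup n) q'.out := by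
    refine (eventually_all_finset T).2 fun w hw ↦ ?_
    haveI := hfin w (hT w hw)
    refine eventually_all.2 fun q ↦ eventually_all.2 fun q' ↦ ?_
    by_cases hqq : q = q'
    · exact Eventually.of_forall fun n h ↦ (h hqq).elim
    · have hne : DoubleCoset.mk (decomp (K := K) w) κ.kerSubgroup q.out ≠ DoubleCoset.mk (decomp (K := K) w) κ.kerSubgroup q'.out := by
        rwa [DoubleCoset.out_eq', DoubleCoset.out_eq']
      exact (eventually_doubleCoset_mk_ne (decomp (K := K) w) (Coinv.isClosed_decomp w) κ.layerSubgroup κ.layerSubgroup_antitone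
        (fun k ↦ Subgroup.isClosed_of_isOpen _ (κ.isOpen_layerSubgroup k)) κ.kerSubgroup
        (by rw [iInf_layerSubgroup_eq_ker]; exact le_rfl) hne).mono fun n h _ ↦ h
  obtain ⟨N, hN₀, hbN, hsN⟩ := ((eventually_ge_atTop n₀).and (hbirth.and hsep)).exists
  -- the layer-`N` data
  set U := κ.layerSubgroup N with hU
  have hKU : κ.kerSubgroup ≤ U := κ.kerSubgroup_le_layerSubgroup N
  choose τN hτN using hbN
  have hinj : ∀ w ∈ T, ∀ q q' : DoubleCoset.Quotient (decomp (K := K) w : Set (absoluteGaloisGroup K))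
      (κ.kerSubgroup : Set (absoluteGaloisGroup K)),
      DoubleCoset.mk (decomp (K := K) w) U q.out = DoubleCoset.mk (decomp (K := K) w) U q'.out → q = q' :=
    fun w hw q q' h ↦ by_contra fun hne ↦ hsN w hw q q' hne h
  -- (3) TRANSPORT: the layer-`N` targets, one per place of `K_N` above `w ∈ T` in the image, with their transport property
  have hF : ∀ w (hw : w ∈ T) (Q : DoubleCoset.Quotient (decomp (K := K) w : Set (absoluteGaloisGroup K)) (U : Set (absoluteGaloisGroup K))),
      ∃ t : subgroupH1 (decompIn U w) M,
        ∀ q : DoubleCoset.Quotient (decomp (K := K) w : Set (absoluteGaloisGroup K)) (κ.kerSubgroup : Set (absoluteGaloisGroup K)),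
          DoubleCoset.mk (decomp (K := K) w) U q.out = Q →
          ∀ zN : subgroupH1 U M,
            resOfLe M (inertiaIn_le_decompIn U w)
              (resH1Hom (decompInToH U w) (AddMonoidHom.id M) (fun _ _ ↦ rfl) (conjH1 U M Q.out zN) - t) = 0 →
            resOfLe M (inertiaIn_le_decompIn U w)
              (resH1Hom (decompInToH U w) (AddMonoidHom.id M) (fun _ _ ↦ rfl) (conjH1 U M q.out zN) - τN w hw q) = 0 := by
    intro w hw Q
    by_cases hQ : ∃ q₀ : DoubleCoset.Quotient (decomp (K := K) w : Set (absoluteGaloisGroup K))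
        (κ.kerSubgroup : Set (absoluteGaloisGroup K)), DoubleCoset.mk (decomp (K := K) w) U q₀.out = Q
    · obtain ⟨q₀, hq₀⟩ := hQ
      -- `Q.out = d · q₀.out · u`
      obtain ⟨d, hd, u, hu, hout⟩ := (DoubleCoset.eq (decomp (K := K) w) U q₀.out Q.out).1
        (hq₀.trans (DoubleCoset.out_eq' _ _ Q).symm)
      refine ⟨conjH1 (decompIn U w) M (⟨d, hd⟩ : decomp (K := K) w) (τN w hw q₀), fun q hq zN hm ↦ ?_⟩
      obtain rfl : q = q₀ := hinj w hw q q₀ (hq.trans hq₀.symm)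
      rw [hout] at hm
      exact matching_of_matching_conj M w U ⟨d, hd⟩ hu q.out zN (τN w hw q) hm
    · exact ⟨0, fun q hq ↦ (hQ ⟨q, hq⟩).elim⟩
  choose F hF using hF
  let τs : (w : HeightOneSpectrum (𝓞 K)) →
      DoubleCoset.Quotient (decomp (K := K) w : Set (absoluteGaloisGroup K)) (U : Set (absoluteGaloisGroup K)) →
        subgroupH1 (decompIn U w) M :=
    fun w Q ↦ if hw : w ∈ T then F w hw Q else 0
  -- the layer-`N` surjectivity
  obtain ⟨zN, hmN, huN⟩ := hLSn N hN₀ T hT τs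
  refine ⟨resOfLe M hKU zN, fun w hw q ↦ ?_, fun w hwT hPw σ ↦ ?_⟩
  · -- (4) DESCENT of the matching condition
    have hm := hmN w hw (DoubleCoset.mk (decomp (K := K) w) U q.out)
    have hτs : τs w (DoubleCoset.mk (decomp (K := K) w) U q.out) = F w hw (DoubleCoset.mk (decomp (K := K) w) U q.out) := dif_pos hw
    rw [hτs] at hm
    have hmq := hF w hw _ q rfl zN hm
    rw [← hτN w hw q]
    exact matching_resOfLe M w hKU q.out zN (τN w hw q) hmq
  · -- (4) DESCENT of the unramified condition
    have hnat : conjH1 κ.kerSubgroup M σ (resOfLe M hKU zN) = resOfLe M hKU (conjH1 U M σ zN) :=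
      (DFunLike.congr_fun (resOfLe_comp_conjH1_holds (M := M) hKU σ) zN).symm
    rw [hnat]
    exact resOfLe_mem_unramifiedKer M w hKU (huN w hwT hPw σ)

end Limit

end Summit.BirchSwinnertonDyer.BirchSwinnertonDyer.Theorems.PrintCf2.LocSurjLimit

end
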